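import Summits.CriticalPhenomena.CardyFormulaZ2.Theorems.CardyComplexConeParafermionToSLESixFamiliesDiamondTraceChain
import Summits.CriticalPhenomena.CardyFormulaZ2.Theorems.CardyComplexConeParafermionToSLESixFamiliesDiamondVertexRelationArcA
import HarnessLib
import Literature.Probability.LatticeModels.MedialWindingBridge

/-!
# The wired-side trace: the face potential along the tip cells of a wired side, via the vertex relation at
# interior–wired-arc edges and the forced block of the three `A`-corner darts (line `potential-darboux-picard-diamond`, S1″)

Crux `ParafermionToSLESixFamilies` (stmt-CriticalPhenomena-11389), line `potential-darboux-picard-diamond`, stub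
`stub_exactPotentialTracePh2` (S1″), clause (DIR) on a WIRED side. Along a straight wired side the boundary cells are the
TIP CELLS `f = faceAt a j`: one interior corner, two corners `a, a′` on the first layer of the wired arc `A`, one on the
second; consecutive tip cells `f = faceAt a j`, `f⁺ = faceAt a (j+2)` share the `A`-site `a`, with the chain cell
`faceAt a (j+3)` between them. Wave 1 found that the increments `Ψ f⁺ − Ψ f` of an exact pair are NOT individually
aligned but become so once summed (block structure of the three `A`-corner darts of a tip cell). This file proves the
exact, configuration-free part for one admissible datum:

* `cornerObs_closedAt_arcA` — the landed vertex relation at an interior–`A` edge (`stub_vertexRelationArcA`) in corner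
  coordinates; `exactPair_increment_arcA` — hence an exact pair steps across the `A`-site `a` between two inner faces
  `faceAt a k`, `faceAt a (k+3)` sharing the interior edge `{a, a + u_k}` by
  `Ψ (faceAt a (k+3)) − Ψ (faceAt a k) = i^k E(a, faceAt a k) − i^{k+3} E(a, faceAt a (k+3))`
  (the potential "extended to `a`", in difference form — no global extension is needed);
* `exactPair_tipIncrement` — across the two interior edges at `a`:
  `Ψ (faceAt a (j+2)) − Ψ (faceAt a j) = i^j · (E(a, faceAt a j) + E(a, faceAt a (j+2)))`;
* `cornerObs_of_openStep` — the phase step across a FORCED-OPEN (`A`–`A`) edge: the next dart around the same face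
  has `cornerObs` multiplied by `e^{+iπ/6}` (one right quarter-turn); `cornerObs_thirdDart` — so the last of the three
  `A`-corner darts of the tip cell `faceAt a (j+2)` carries `e^{iπ/3}` times the observable of its first dart
  `(a − u_{j+1} + u_{j+2}, j)`;
* `exactPair_wiredChainSum_of_phase` (registered, `--supports` the crux) — along a run of consecutive tip cells
  `faceAt (a m) j`, `a (m+1) = a m − u_j − u_{j+1}`, whose first darts `(a m, j)` have the constant passage phase `ζ`:
  `Ψ (faceAt (a N) j) − Ψ (faceAt (a 0) j) = i^j ζ · (Σ_{m<N} P m + e^{iπ/3} Σ_{m<N} P (m+1))`, `P m` the passage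
  probability of `(a m, j)` — i.e. `i^j ζ (1 + e^{iπ/3}) Σ P` up to two boundary terms of modulus `≤ 1`: the wired trace
  runs in ONE direction `i^j e^{iπ/6} ζ` with slack `2`.

Pure lattice statements; nothing cited.
-/

noncomputable section

namespace Summit.CriticalPhenomena.CardyFormulaZ2.Cruxes.ParafermionToSLESixFamilies.PotentialDarbouxPicardDiamond

open scoped BigOperators
open MeasureTheory Filter Set Complex
open Literature.Probability Literature.Probability.LatticeModels Literature.Probability.Percolation
open Literature.Probability.LatticeModels.DiscreteDobrushin
open Literature.Probability.RandomPlanarGeometry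
open Summit.CriticalPhenomena.CardyFormulaZ2.Cruxes.EdgePrecompact.QkzStripBoundaryArm (cornerObs)
open Summit.CriticalPhenomena.CardyFormulaZ2.Cruxes.ParafermionToSLESixFamilies.IicTraceFluxPairing
  (passesCornerAt_iff_cornerOrbit_eq passesCorner_iff_exists_cornerOrbit_eq measurableSet_passesCorner touchProb)

variable {E : DiscreteDobrushin}

/-! ## The vertex relation at an interior–wired-arc edge, in corner coordinates -/

/-- **The vertex relation at an edge with at most one wired-arc endpoint, in corner coordinates.** For Jordan data,
admissible, and an edge `{x, x + u_k}` with no endpoint on `B`, not both endpoints on `A`, and both faces `faceAt x k`,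
`faceAt x (k+3)` inner: `E(x, k) − E(x + u_k, k + 2) = i (E(x + u_k, k + 1) − E(x, k + 3))`. -/
theorem cornerObs_closedAt_arcA (D : DobrushinDomain) (hΩ : E.Ω = D.carrier) (hE : E.IsZdAdmissible) {x : Site 2}
    {k : Fin 4} (hxB : x ∉ E.zdArcB) (hyB : x + cornerUnit k ∉ E.zdArcB) (hA : x ∉ E.zdArcA ∨ x + cornerUnit k ∉ E.zdArcA)
    (h₁ : E.IsInnerFace (faceAt x k)) (h₂ : E.IsInnerFace (faceAt x (k + 3))) :
    cornerObs E E.δ x (faceAt x k) - cornerObs E E.δ (x + cornerUnit k) (faceAt (x + cornerUnit k) (k + 2)) =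
      I * (cornerObs E E.δ (x + cornerUnit k) (faceAt (x + cornerUnit k) (k + 1)) -
        cornerObs E E.δ x (faceAt x (k + 3))) := by
  have hT : cTgt ((x, k + 3) : Site 2 × Fin 4) = s(x, x + cornerUnit k) := by
    simp only [cTgt, fin4_add_three_add_one]
  have he : cTgt ((x, k + 3) : Site 2 × Fin 4) ∈ (discreteDomainGraph E.Ω E.δ).edgeSet := by
    rw [hT]; exact adj_of_isInnerFace_faceAt h₁ (Or.inl rfl)
  have hB : ∀ y ∈ cTgt ((x, k + 3) : Site 2 × Fin 4), y ∉ E.zdArcB := by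
    rw [hT]; intro y hy
    rcases Sym2.mem_iff.1 hy with rfl | rfl
    · exact hxB
    · exact hyB
  have hA' : ∃ y ∈ cTgt ((x, k + 3) : Site 2 × Fin 4), y ∉ E.zdArcA := by
    rw [hT]
    rcases hA with h | h
    · exact ⟨x, Sym2.mem_mk_left _ _, h⟩
    · exact ⟨x + cornerUnit k, Sym2.mem_mk_right _ _, h⟩
  have hin₂ : E.IsInnerFace (faceAt ((x, k + 3) : Site 2 × Fin 4).1 (((x, k + 3) : Site 2 × Fin 4).2 + 1)) := by
    show E.IsInnerFace (faceAt x (k + 3 + 1))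
    rw [fin4_add_three_add_one]; exact h₁
  have key := cornerObs_vertexRelation_arcA D hΩ hE (p := (x, k + 3)) he hB hA' h₂ hin₂
  simpa only [cFace, cornerPartner, fin4_add_three_add_one, fin4_three_two, fin4_add_three_add_three] using key

/-- **An exact pair steps across a wired-arc site.** For an exact pair `(Φ, Ψ)` at mesh `E.δ`, a site `a` off `B` whose
neighbour `a + u_k` is off both arcs, with the faces `faceAt a k`, `faceAt a (k+3)` of the edge `{a, a + u_k}` inner:
`Ψ (faceAt a (k+3)) − Ψ (faceAt a k) = i^k E(a, faceAt a k) − i^{k+3} E(a, faceAt a (k+3))`. (The two exact-pair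
increments at the interior endpoint, converted by the vertex relation at the edge; for `a ∈ A` this is the increment of
the potential extended to `a`.) -/
theorem exactPair_increment_arcA (D : DobrushinDomain) (hΩ : E.Ω = D.carrier) (hE : E.IsZdAdmissible)
    {Φ Ψ : Site 2 → ℂ} (hP : IsExactPair E E.δ Φ Ψ) {a : Site 2} {k : Fin 4} (haB : a ∉ E.zdArcB)
    (hyA : a + cornerUnit k ∉ E.zdArcA) (hyB : a + cornerUnit k ∉ E.zdArcB) (h₁ : E.IsInnerFace (faceAt a k))
    (h₂ : E.IsInnerFace (faceAt a (k + 3))) :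
    Ψ (faceAt a (k + 3)) - Ψ (faceAt a k) =
      I ^ (k : ℕ) * cornerObs E E.δ a (faceAt a k) - I ^ ((k + 3 : Fin 4) : ℕ) * cornerObs E E.δ a (faceAt a (k + 3)) := by
  have VR := cornerObs_closedAt_arcA D hΩ hE haB hyB (Or.inr hyA) h₁ h₂
  have hf₁ : faceAt (a + cornerUnit k) (k + 1) = faceAt a k := faceAt_add_unit_succ a k
  have hf₂ : faceAt (a + cornerUnit k) (k + 2) = faceAt a (k + 3) := faceAt_add_unit_add_two a k
  have h₁' : E.IsInnerFace (faceAt (a + cornerUnit k) (k + 1)) := by rw [hf₁]; exact h₁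
  have h₂' : E.IsInnerFace (faceAt (a + cornerUnit k) (k + 2)) := by rw [hf₂]; exact h₂
  have e₁ : Φ (a + cornerUnit k) - Ψ (faceAt (a + cornerUnit k) (k + 1)) =
      classWeight (faceAt (a + cornerUnit k) (k + 1) - (a + cornerUnit k)) *
        cornerObs E E.δ (a + cornerUnit k) (faceAt (a + cornerUnit k) (k + 1)) :=
    hP _ _ (isCorner_faceAt _ _) h₁' hyA hyB
  have e₂ : Φ (a + cornerUnit k) - Ψ (faceAt (a + cornerUnit k) (k + 2)) =
      classWeight (faceAt (a + cornerUnit k) (k + 2) - (a + cornerUnit k)) *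
        cornerObs E E.δ (a + cornerUnit k) (faceAt (a + cornerUnit k) (k + 2)) :=
    hP _ _ (isCorner_faceAt _ _) h₂' hyA hyB
  rw [classWeight_faceAt_sub, hf₁] at e₁
  rw [classWeight_faceAt_sub, hf₂] at e₂
  rw [hf₁, hf₂] at VR
  have hw₁ : I ^ ((k + 1 : Fin 4) : ℕ) = I * I ^ (k : ℕ) := by
    rw [← classWeight_neg_cornerOff_eq_I_pow, ← classWeight_neg_cornerOff_eq_I_pow, classWeight_neg_cornerOff_succ]
  have hw₂ : I ^ ((k + 2 : Fin 4) : ℕ) = -I ^ (k : ℕ) := by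
    rw [← classWeight_neg_cornerOff_eq_I_pow, ← classWeight_neg_cornerOff_eq_I_pow, classWeight_neg_cornerOff_add_two]
  have hw₃ : I ^ ((k + 3 : Fin 4) : ℕ) = -(I * I ^ (k : ℕ)) := by
    rw [← classWeight_neg_cornerOff_eq_I_pow, ← classWeight_neg_cornerOff_eq_I_pow, classWeight_neg_cornerOff_add_three]
  rw [hw₁] at e₁
  rw [hw₂] at e₂
  rw [hw₃]
  linear_combination e₁ - e₂ - I ^ (k : ℕ) * VR

/-- **The tip-to-tip increment.** For an exact pair, a site `a` off `B` whose neighbours `a + u_j`, `a + u_{j+3}` are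
off both arcs, with the three faces `j + 2, j + 3, j` at `a` inner (the next tip cell, the chain cell, the tip cell):
`Ψ (faceAt a (j+2)) − Ψ (faceAt a j) = i^j · (E(a, faceAt a j) + E(a, faceAt a (j+2)))`. -/
theorem exactPair_tipIncrement (D : DobrushinDomain) (hΩ : E.Ω = D.carrier) (hE : E.IsZdAdmissible)
    {Φ Ψ : Site 2 → ℂ} (hP : IsExactPair E E.δ Φ Ψ) {a : Site 2} {j : Fin 4} (haB : a ∉ E.zdArcB)
    (hvA : a + cornerUnit j ∉ E.zdArcA) (hvB : a + cornerUnit j ∉ E.zdArcB)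
    (hv'A : a + cornerUnit (j + 3) ∉ E.zdArcA) (hv'B : a + cornerUnit (j + 3) ∉ E.zdArcB)
    (h₀ : E.IsInnerFace (faceAt a j)) (h₂ : E.IsInnerFace (faceAt a (j + 2))) (h₃ : E.IsInnerFace (faceAt a (j + 3))) :
    Ψ (faceAt a (j + 2)) - Ψ (faceAt a j) =
      I ^ (j : ℕ) * (cornerObs E E.δ a (faceAt a j) + cornerObs E E.δ a (faceAt a (j + 2))) := by
  have s₁ := exactPair_increment_arcA D hΩ hE hP haB hvA hvB h₀ h₃
  have h33 : j + 3 + 3 = j + 2 := fin4_add_three_add_three j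
  have s₂ := exactPair_increment_arcA D hΩ hE hP (k := j + 3) haB hv'A hv'B h₃ (by rw [h33]; exact h₂)
  rw [h33] at s₂
  have hw₂ : I ^ ((j + 2 : Fin 4) : ℕ) = -I ^ (j : ℕ) := by
    rw [← classWeight_neg_cornerOff_eq_I_pow, ← classWeight_neg_cornerOff_eq_I_pow, classWeight_neg_cornerOff_add_two]
  rw [hw₂] at s₂
  linear_combination s₁ + s₂

/-! ## The phase step across a forced-open edge -/

/-- Across an open target edge the orbit follows it: the next corner is `(u + u_{j+1}, j + 3)`, same face. -/
theorem cornerOrbit_succ_of_open {β : BondConfig (Site 2)} {c₀ : Site 2 × Fin 4} {n : ℕ} {u : Site 2} {j : Fin 4}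
    (hn : cornerOrbit β c₀ n = (u, j)) (hopen : cTgt (u, j) ∈ β) :
    cornerOrbit β c₀ (n + 1) = (u + cornerUnit (j + 1), j + 3) := by
  change nextCorner β (cornerOrbit β c₀ n) = _
  rw [hn, nextCorner_of_mem hopen]

/-- Across an open target edge the turn count drops by one (a right turn). -/
theorem turnCount_succ_of_open {β : BondConfig (Site 2)} {c₀ : Site 2 × Fin 4} {n : ℕ} {u : Site 2} {j : Fin 4}
    (hn : cornerOrbit β c₀ n = (u, j)) (hopen : cTgt (u, j) ∈ β) : turnCount β c₀ (n + 1) = turnCount β c₀ n - 1 := by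
  rw [turnCount_succ, hn, turnSign_of_mem hopen]; ring

/-- The orbit corner BEFORE a visit to `(u + u_{j+1}, j + 3)` is `(u, j)` when the edge between them is open. -/
theorem cornerOrbit_pred_of_open {β : BondConfig (Site 2)} {c₀ : Site 2 × Fin 4} {n : ℕ} {u : Site 2} {j : Fin 4}
    (hn : cornerOrbit β c₀ (n + 1) = (u + cornerUnit (j + 1), j + 3)) (hopen : cTgt (u, j) ∈ β) :
    cornerOrbit β c₀ n = (u, j) := by
  apply nextCorner_injective (β := β)
  change cornerOrbit β c₀ (n + 1) = nextCorner β (u, j)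
  rw [hn, nextCorner_of_mem hopen]

/-- The visits of `(u + u_{j+1}, j + 3)` are the visits of `(u, j)` shifted by one step, when `cTgt (u, j)` is open,
the (common) face is inner and `(u + u_{j+1}, j + 3)` is not the start corner. -/
theorem filter_orbit_openStep_eq_image (hE : E.IsZdAdmissible) (ω : BondConfig (Site 2)) {u : Site 2} {j : Fin 4}
    (hopen : cTgt (u, j) ∈ E.bcBondConfig ω) (hinner : E.IsInnerFace (faceAt u j))
    (hstart : startCorner hE ≠ (u + cornerUnit (j + 1), j + 3)) :
    (Finset.range (exitTime hE ω)).filter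
        (fun k => cornerOrbit (E.bcBondConfig ω) (startCorner hE) k = (u + cornerUnit (j + 1), j + 3)) =
      ((Finset.range (exitTime hE ω)).filter
        (fun k => cornerOrbit (E.bcBondConfig ω) (startCorner hE) k = (u, j))).image (· + 1) := by
  ext k'
  simp only [Finset.mem_filter, Finset.mem_range, Finset.mem_image]
  constructor
  · rintro ⟨hk', horb⟩
    obtain ⟨k, rfl⟩ : ∃ k, k' = k + 1 := by
      rcases k' with _ | k
      · exact absurd horb hstart
      · exact ⟨k, rfl⟩
    exact ⟨k, ⟨by omega, cornerOrbit_pred_of_open horb hopen⟩, rfl⟩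
  · rintro ⟨k, ⟨hk, horb⟩, rfl⟩
    have hsucc := cornerOrbit_succ_of_open horb hopen
    refine ⟨?_, hsucc⟩
    rcases Nat.lt_or_ge (k + 1) (exitTime hE ω) with h | h
    · exact h
    · exfalso
      have hk1 : k + 1 = exitTime hE ω := by omega
      have := not_isInnerFace_exitTime hE ω
      rw [← hk1, hsucc] at this
      refine this ?_
      show E.IsInnerFace (faceAt (u + cornerUnit (j + 1)) (j + 3))
      rw [show j + 3 = j + 1 + 2 by rw [fin4_add_one_add_two], faceAt_add_unit_add_two, fin4_add_one_add_three]
      exact hinner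

/-- **The phase step of the corner observable across a forced-open edge.** If `cTgt (u, j)` is open in every completed
configuration (an `A`–`A` edge of `Ω_δ`), the face `faceAt u j` is inner and `(u + u_{j+1}, j + 3)` is not the start
corner: `cornerObs E δ (u + u_{j+1}) (faceAt u j) = e^{+iπ/6} · cornerObs E δ u (faceAt u j)` (every visit of
`(u, j)` is followed by the visit of the next dart of the same face, one right quarter-turn later, and conversely). -/
theorem cornerObs_of_openStep (hE : E.IsZdAdmissible) {δ : ℝ} (hδ : δ ≠ 0) {u : Site 2} {j : Fin 4}
    (hopen : ∀ ω, cTgt (u, j) ∈ E.bcBondConfig ω) (hinner : E.IsInnerFace (faceAt u j))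
    (hstart : startCorner hE ≠ (u + cornerUnit (j + 1), j + 3)) :
    cornerObs E δ (u + cornerUnit (j + 1)) (faceAt u j) = Complex.exp ((Real.pi / 6 : ℝ) * I) * cornerObs E δ u (faceAt u j) := by
  have hface : faceAt u j = faceAt (u + cornerUnit (j + 1)) (j + 3) := by
    rw [show j + 3 = j + 1 + 2 by rw [fin4_add_one_add_two], faceAt_add_unit_add_two, fin4_add_one_add_three]
  unfold cornerObs
  -- buildfix 2026-08-20 (proof-only, regime-robust): `cornerObs` spells the fully-qualified
  -- `Literature.Probability.LatticeModels.winding` (= `FermionicObservable`'s copy whenever that module is in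
  -- the closure); realign it with the `Polyline.winding` of this file's lemmas (`MedialWindingBridge`; a
  -- syntactic identity once the Literature dedupe lands).
  rw [← Literature.Probability.LatticeModels.Polyline.winding_eq_winding']
  rw [← integral_const_mul]
  refine integral_congr_ae (Eventually.of_forall fun ω => ?_)
  simp only
  conv_lhs => rw [hface]
  rw [cornerObs_integrand_eq hE hδ (u + cornerUnit (j + 1)) (j + 3) ω, cornerObs_integrand_eq hE hδ u j ω,
    filter_orbit_openStep_eq_image hE ω (hopen ω) hinner hstart, Finset.sum_image fun a _ b _ h => by simpa using h,
    Finset.mul_sum]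
  refine Finset.sum_congr rfl fun k hk => ?_
  rw [Finset.mem_filter] at hk
  rw [turnCount_succ_of_open hk.2 (hopen ω), ← Complex.exp_add]
  congr 1
  push_cast
  ring

/-- An `A`–`A` edge of `Ω_δ` is open in every completed configuration. -/
theorem cTgt_mem_bcBondConfig_of_arcA {u : Site 2} {j : Fin 4} (hu : u ∈ E.zdArcA) (hv : u + cornerUnit (j + 1) ∈ E.zdArcA)
    (hinner : E.IsInnerFace (faceAt u j)) (ω : BondConfig (Site 2)) : cTgt (u, j) ∈ E.bcBondConfig ω := by
  refine mem_bcBondConfig_of_arcA (adj_of_isInnerFace_faceAt hinner (Or.inr (fin4_add_one_add_three j).symm)) ?_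
  intro y hy
  rcases Sym2.mem_iff.1 hy with rfl | rfl
  · exact hu
  · exact hv

/-- **The third `A`-corner dart of a tip cell carries `e^{iπ/3}` times the observable of its first dart.** Let `a ∈ A`
with `a₀ = a + u_{j+2} ∈ A` and `a₁ = a₀ + u_{j+3} ∈ A` (so that the three corners `a₁, a₀, a` of the face
`f = faceAt a (j+2)` lie on `A` and its sides `{a₁, a₀}`, `{a₀, a}` are forced open), `f` inner. Then
`E(a, faceAt a (j+2)) = e^{iπ/3} · E(a₁, faceAt a₁ j)`. -/
theorem cornerObs_thirdDart (hE : E.IsZdAdmissible) {δ : ℝ} (hδ : δ ≠ 0) {a : Site 2} {j : Fin 4} (ha : a ∈ E.zdArcA)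
    (ha₀ : a + cornerUnit (j + 2) ∈ E.zdArcA) (ha₁ : a + cornerUnit (j + 2) + cornerUnit (j + 3) ∈ E.zdArcA)
    (hf : E.IsInnerFace (faceAt a (j + 2))) :
    cornerObs E δ a (faceAt a (j + 2)) = Complex.exp ((Real.pi / 3 : ℝ) * I) *
      cornerObs E δ (a + cornerUnit (j + 2) + cornerUnit (j + 3)) (faceAt (a + cornerUnit (j + 2) + cornerUnit (j + 3)) j) := by
  set a₀ := a + cornerUnit (j + 2) with ha₀def
  set a₁ := a₀ + cornerUnit (j + 3) with ha₁def
  -- the face seen from its three `A`-corners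
  have hf₀ : faceAt a₀ (j + 3) = faceAt a (j + 2) := by
    rw [ha₀def, show j + 3 = j + 2 + 1 by rw [fin4_add_two_add_one], faceAt_add_unit_succ]
  have hf₁ : faceAt a₁ j = faceAt a (j + 2) := by
    rw [← hf₀, ha₁def]
    have := faceAt_add_unit_succ a₀ (j + 3)
    rwa [fin4_add_three_add_one] at this
  -- no start corner inside the block: the start corner's target-side neighbour is on `B`
  have hc₀ := isStartCorner_startCorner hE
  have hnotB : ∀ {y : Site 2}, y ∈ E.zdArcA → y ∉ E.zdArcB := fun hy hyB => Set.disjoint_left.1 hE.disjoint hy hyB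
  have hback₁ : a₁ + cornerUnit (j + 1) = a₀ := by
    rw [ha₁def, add_assoc, show j + 3 = j + 1 + 2 by rw [fin4_add_one_add_two], cornerUnit_add_two]; simp
  have hback₀ : a₀ + cornerUnit (j + 3 + 1) = a := by
    rw [fin4_add_three_add_one, ha₀def, add_assoc, show j + 2 = j + 0 + 2 by simp, cornerUnit_add_two]; simp
  have hstart₀ : startCorner hE ≠ (a₁ + cornerUnit (j + 1), j + 3) := by
    rw [hback₁]
    intro h
    have := hc₀.mem_zdArcB
    rw [h] at this
    exact hnotB ha₁ this
  have hstart : startCorner hE ≠ (a₀ + cornerUnit (j + 3 + 1), j + 3 + 3) := by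
    rw [hback₀, fin4_add_three_add_three]
    intro h
    have := hc₀.mem_zdArcB
    rw [h] at this
    exact hnotB ha₀ this
  rw [hf₁]
  -- first step: `(a₁, j) → (a₀, j+3)`
  have hopen₁ : ∀ ω, cTgt (a₁, j) ∈ E.bcBondConfig ω := fun ω =>
    cTgt_mem_bcBondConfig_of_arcA ha₁ (by rw [hback₁]; exact ha₀) (by rw [hf₁]; exact hf) ω
  have step₁ := cornerObs_of_openStep hE hδ hopen₁ (by rw [hf₁]; exact hf) hstart₀
  rw [hback₁, hf₁] at step₁
  -- second step: `(a₀, j+3) → (a, j+2)`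
  have hopen₀ : ∀ ω, cTgt (a₀, j + 3) ∈ E.bcBondConfig ω := fun ω =>
    cTgt_mem_bcBondConfig_of_arcA ha₀ (by rw [hback₀]; exact ha) (by rw [hf₀]; exact hf) ω
  have step₀ := cornerObs_of_openStep hE hδ hopen₀ (by rw [hf₀]; exact hf) hstart
  rw [hback₀, hf₀] at step₀
  rw [step₀, step₁, ← mul_assoc, ← Complex.exp_add]
  congr 2
  push_cast
  ring

/-! ## The wired chain sum -/

/-- **The wired chain sum with a constant first-dart phase** (registered helper of `stub_exactPotentialTracePh2`). For
Jordan data `E` (`E.Ω = D.carrier`), admissible, an exact pair `(Φ, Ψ)` at mesh `E.δ`, an orientation `j`, a phase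
`ζ`, and a run `a 0, …, a N` of first-layer wired-arc sites (`a (m+1) = a m − u_j − u_{j+1}`), each with: `a m ∈ A`,
its interior neighbours `a m + u_j`, `a m + u_{j+3}` off both arcs, its outer neighbours `a m + u_{j+2}`,
`a m + u_{j+2} + u_{j+3}` on `A`, the faces `j, j+2, j+3` at `a m` inner, and the constant passage phase
`e^{-iπ·turnCount/6} = ζ` at the first darts `(a m, j)`: writing `P m` for the passage probability of `(a m, faceAt (a m) j)`,
`Ψ (faceAt (a N) j) − Ψ (faceAt (a 0) j) = i^j ζ · (Σ_{m<N} P m + e^{iπ/3} Σ_{m<N} P (m+1))`. -/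
theorem exactPair_wiredChainSum_of_phase : ∀ (D : DobrushinDomain) (E : DiscreteDobrushin) (hΩ : E.Ω = D.carrier) (hE : E.IsZdAdmissible) (Φ Ψ : Site 2 → ℂ), IsExactPair E E.δ Φ Ψ → ∀ (j : Fin 4) (ζ : ℂ) (a : ℕ → Site 2) (N : ℕ), (∀ m < N, a (m + 1) = a m - cornerUnit j - cornerUnit (j + 1)) → (∀ m ≤ N, a m ∈ E.zdArcA ∧ a m + cornerUnit j ∉ E.zdArcA ∧ a m + cornerUnit j ∉ E.zdArcB ∧ a m + cornerUnit (j + 3) ∉ E.zdArcA ∧ a m + cornerUnit (j + 3) ∉ E.zdArcB ∧ a m + cornerUnit (j + 2) ∈ E.zdArcA ∧ a m + cornerUnit (j + 2) + cornerUnit (j + 3) ∈ E.zdArcA ∧ E.IsInnerFace (faceAt (a m) j) ∧ E.IsInnerFace (faceAt (a m) (j + 2)) ∧ E.IsInnerFace (faceAt (a m) (j + 3))) → (∀ m ≤ N, ∀ (ω : BondConfig (Site 2)) (t : ℕ), t < exitTime hE ω → cornerOrbit (E.bcBondConfig ω) (startCorner hE) t = (a m, j) → Complex.exp (-(Real.pi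 / 6 * turnCount (E.bcBondConfig ω) (startCorner hE) t : ℝ) * I) = ζ) → Ψ (faceAt (a N) j) - Ψ (faceAt (a 0) j) = I ^ (j : ℕ) * ζ * (∑ m ∈ Finset.range N, ((bondPercolation (zdGraph 2) half).real {ω : BondConfig (Site 2) | ∃ k : ℕ, (medialExploration E ω)[k]? = some (cornerSource (a m) (faceAt (a m) j)) ∧ (medialExploration E ω)[k + 1]? = some (cornerTarget (a m) (faceAt (a m) j))} : ℂ) + Complex.exp ((Real.pi / 3 : ℝ) * I) * ∑ m ∈ Finset.range N, ((bondPercolation (zdGraph 2) half).real {ω : BondConfig (Site 2) | ∃ k : ℕ, (medialExploration E ω)[k]? = some (cornerSource (a (m + 1)) (faceAt (a (m + 1)) j)) ∧ (medialExploration E ω)[k + 1]? = some (cornerTarget (a (m + 1)) (faceAt (a (m + 1)) j))} : ℂ)) := by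
  intro D E hΩ hE Φ Ψ hP j ζ a N ha hgeo hζ
  have hδ : E.δ ≠ 0 := hE.delta_pos.ne'
  have hnotB : ∀ {y : Site 2}, y ∈ E.zdArcA → y ∉ E.zdArcB := fun hy hyB => Set.disjoint_left.1 hE.disjoint hy hyB
  -- the observable at the first dart of cell `m`, and at the third dart of cell `m + 1` seen from `a m`
  have hfirst : ∀ m ≤ N, cornerObs E E.δ (a m) (faceAt (a m) j) = ζ * (bondPercolation (zdGraph 2) half).real
      {ω : BondConfig (Site 2) | ∃ k : ℕ, (medialExploration E ω)[k]? = some (cornerSource (a m) (faceAt (a m) j)) ∧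
        (medialExploration E ω)[k + 1]? = some (cornerTarget (a m) (faceAt (a m) j))} :=
    fun m hm => cornerObs_eq_const_mul_real_passes hE hδ (hζ m hm)
  have hthird : ∀ m < N, cornerObs E E.δ (a m) (faceAt (a m) (j + 2)) =
      Complex.exp ((Real.pi / 3 : ℝ) * I) * cornerObs E E.δ (a (m + 1)) (faceAt (a (m + 1)) j) := by
    intro m hm
    obtain ⟨haA, -, -, -, -, ha₀, ha₁, -, h₂, -⟩ := hgeo m hm.le
    have hnext : a m + cornerUnit (j + 2) + cornerUnit (j + 3) = a (m + 1) := by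
      rw [ha m hm, show j + 2 = j + 0 + 2 by simp, cornerUnit_add_two, show j + 3 = j + 1 + 2 by rw [fin4_add_one_add_two],
        cornerUnit_add_two]
      simp [sub_eq_add_neg, add_assoc]
    rw [cornerObs_thirdDart hE hδ haA ha₀ ha₁ h₂, hnext]
  induction N with
  | zero => simp
  | succ N ih =>
    have ih' := ih (fun m hm => ha m (Nat.lt_succ_of_lt hm)) (fun m hm => hgeo m (Nat.le_succ_of_le hm))
      (fun m hm => hζ m (Nat.le_succ_of_le hm)) (fun m hm => hfirst m (Nat.le_succ_of_le hm))
      (fun m hm => hthird m (Nat.lt_succ_of_lt hm))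
    obtain ⟨haA, hvA, hvB, hv'A, hv'B, -, -, h₀, h₂, h₃⟩ := hgeo N (Nat.le_succ N)
    have htip := exactPair_tipIncrement D hΩ hE hP (hnotB haA) hvA hvB hv'A hv'B h₀ h₂ h₃
    have hshare : faceAt (a (N + 1)) j = faceAt (a N) (j + 2) := by rw [ha N (Nat.lt_succ_self N), faceAt_sub_units]
    rw [Finset.sum_range_succ, Finset.sum_range_succ, show Ψ (faceAt (a (N + 1)) j) = Ψ (faceAt (a N) (j + 2)) by rw [hshare]]
    rw [hthird N (Nat.lt_succ_self N), hfirst N (Nat.le_succ N), hfirst (N + 1) le_rfl] at htip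
    linear_combination ih' + htip

end Summit.CriticalPhenomena.CardyFormulaZ2.Cruxes.ParafermionToSLESixFamilies.PotentialDarbouxPicardDiamond

end
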